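import Summits.ResolutionOfSingularities.ResolutionOfSingularities.Theorems.UniformComplexityCampaignW82FamilyResolution
import Mathlib.FieldTheory.Perfect
import HarnessLib

/-!
# [OURS · L1 W8.2] RESOLUTION IN FAMILIES WITH PURELY INSEPARABLE BASE EXTENSIONS — the FAMILY FORM of
# door 1 (`UniversalCells` / `PrimeFieldToPerfect`) of slot W8.2; campaign statements, Theses-free module

Cell `res-hironaka` (run/shared/lean/pub/res-hironaka/), LADDER-RESOLUTION rung L (RESCUE), slot W8.2 of
plan/RESCUE-SEED.md («PRIME-FIELD / UNIVERSALITY TRANSFER instead of descent: resolve over 𝔽_p or 𝔽̄_p and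
transfer FAMILIES»). FIRST DOOR: route `UniversalCells`, item `PrimeFieldToPerfect`
(stmt-ResolutionOfSingularities-15233: resolution over `Spec (ZMod p)` ⇒ resolution over every PERFECT field
of characteristic `p`; its residual of record is the perfection step / `ClimbRatFuncPerf`). Sequel, for
PERFECT target fields, of the door-2 module `Theorems/UniformComplexityCampaignW82FamilyResolution.lean`
(p526769: `IsWeakResolution`, `FamilyResolution k` — algebraic base extensions, algebraically closed targets;
kernel-checked `↔` the door-2 crux slice, p530650). Self-typed by res-L1-s82-pv-2 (gen 5) under the rung-B
precedent; NOTHING is proved about resolution of singularities here: one `def`, one anchor.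

WHY THIS FILE. Over a PERFECT (not algebraically closed) field `K`, a `K`-point of the base `Spec A` of a
family lifts along a base extension `A → A'` only if the extension is PURELY INSEPARABLE (radicial) at the
generic point; and the spreading theorem (`PrimeModelTransfer.exists_familyResolution_datum_embedding`)
produces, from a resolution over the PERFECT CLOSURE `(Frac A)^{perf}`, a base extension `A' ⊆ (Frac A)^{perf}`,
i.e. a radicial one. So the door-1 analogue of `FamilyResolution` asks for the base extension to be
RADICIAL and the geometric generic fibre to be taken over the perfect closure:

* `FamilyResolutionInsep p k` — for every finitely generated `k`-domain `A` and every PROPER `f : 𝒳 → Spec A`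
  whose RADICIAL GENERIC FIBRE `𝒳 ×_A Spec L` is integral for some (equivalently every) perfect field `L`
  radicial over `A` — `A → L` injective and every `x : L` satisfies `b · x ^ (p ^ n) = a` for some
  `a, b ∈ A`, `b ≠ 0` (i.e. `L` is a perfect closure of `Frac A`) — there are a domain `A'`, an injective
  finite-type `A`-algebra structure which is RADICIAL in the same sense, and ONE `G : 𝒴 → 𝒳 ×_A Spec A'`
  all of whose field-valued fibres are weak resolutions (`IsWeakResolution`).

Intended theorems (res-L1-s82-pv-2 gen 5, sibling files `…PrimeFieldToPerfectFamilyResolutionInsep*.lean`):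
`FamilyResolutionInsep p k →` resolution of every integral separated finite-type scheme over every PERFECT
`K ⊇ k` of characteristic `p` («⇐»: projective model over a finitely generated `k`-subalgebra `R ⊆ K`; the
`K`-point `R ⊆ K` lifts along the radicial `A'` because `K` is perfect, Mathlib `PerfectRing.lift`); and
(resolution over all perfect fields of characteristic `p`) `→ FamilyResolutionInsep p k` for every `k` of
characteristic `p` («⇒»: the spreading theorem at `L = (Frac A)^{perf}`, the embedding `A' ↪ L` making `A'`
radicial). Hence `PerfectRes p ↔ FamilyResolutionInsep p (ZMod p)`-type links (leaf file).

HONEST FRAMING. The `def` below is OURS — a campaign statement that REPLACES THE ROLE of a printed item of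
H. Hironaka's manuscript *Resolution of singularities in positive characteristics* (2017-03-23,
[Hironaka2017], lit key `paper:url-3343fd9e678b`) — namely §17 ¶2, p.89 l.59–62 («In this work the base
field K is always assumed to be a finite field or Z/pZ … When the K has transcendence degree d we can
reformulate the resolution problem to the case of dimension d + dim Z»; typed AS PRINTED, not asserted, as
`S17Methodology.U89_2` / `U89_3`): the reformulation of a variety over a PERFECT field `K` as a FAMILY over
the prime field returns a resolution over `K` exactly when the family can be resolved fibrewise after a
RADICIAL base extension — the statement below; NOT a statement of the manuscript. Barrier bookkeeping
(`Literature/Barriers/ResolutionOfSingularities/`: `RegularNotGeometricallyRegular.lean`,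
`InseparableBaseChangeResolution.lean` — `not_hasResolution_pullback_extField`,
`not_isRegular_stable_groundFieldExtension` —, `FrobeniusTwistResolution.lean` —
`not_hasResolution_Spec_frobTwist`): the radicial base extension `A → A'` IS the inseparable base change
along which regularity is not stable; the statement asks for fibrewise weak resolutions AFTER it (smooth
fibres in the prover's «⇒»), which is what resolving the regular total space does not provide. Hironaka's
statements are CANDIDATES under adjudication (D-0012/D-0089); nothing here is attributed to the author and
no verdict on the manuscript is implied. AI typing, weaker than expert review.

VACUITY SELF-CHECK (`p` prime, `k` of characteristic `p`): not trivially true (at `A = k` perfect it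
contains resolution of every integral proper geometrically-radicially-integral `k`-scheme, open in
dimension `≥ 4`); not trivially false (implied by resolution over all perfect fields of characteristic `p`,
an instance of the summit conjunct, via the prover's «⇒»); the integrality hypothesis excludes families whose
generic fibre is not geometrically reduced (no weak resolution of the radicial fibres could exist); for `k`
of characteristic `≠ p` the radicial clauses degenerate (not intended).

## References (vocabulary and locators only; nothing cited as a premise)
* H. Hironaka, ms. 2017-03-23, §17 ¶2 p.89 l.59–62 — under adjudication, quoted for the role replaced, not
  asserted. [Hironaka2017]
* A. Grothendieck, J. Dieudonné, EGA IV₃ (1966) Thm. 8.8.2, 8.10.5 (spreading out; docstring vocabulary).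
  [EGAIV3]
-/

noncomputable section

set_option linter.dupNamespace false -- mandated namespace of this single-conjunct summit

open _root_.CategoryTheory _root_.CategoryTheory.Limits _root_.AlgebraicGeometry
open Literature.AlgebraicGeometry.Resolution

namespace Summit.ResolutionOfSingularities.ResolutionOfSingularities.Theorems.CampaignW82

/-- [OURS · L1 W8.2 door 1] replaces the role of §17 ¶2, p.89 l.59–62 («When the K has transcendence degree d
we can reformulate the resolution problem to the case of dimension d + dim Z» — the variety over a PERFECT
field as a FAMILY over the prime field; `S17Methodology.U89_3`) by the statement such a reformulation needs;
NOT a statement of the manuscript. **RESOLUTION IN FAMILIES WITH RADICIAL BASE EXTENSIONS over `k`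
(exponent `p`).** For every finitely generated `k`-domain `A` and every PROPER `f : 𝒳 → Spec A` such that,
for SOME perfect field `L` RADICIAL over `A` — the structure map `A → L` is injective and every `x : L`
satisfies `algebraMap b * x ^ (p ^ n) = algebraMap a` for some `n` and `a, b ∈ A`, `b ≠ 0`; such an `L` is
a perfect closure of `Frac A`, unique up to `A`-isomorphism, so «some» = «every» — the base change
`𝒳 ×_{Spec A} Spec L` is INTEGRAL, there exist a domain `A'` with an INJECTIVE, FINITE-TYPE `A`-algebra
structure that is RADICIAL in the same sense (`∀ x : A', ∃ n a b, b ≠ 0 ∧ algebraMap b * x ^ (p ^ n) =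
algebraMap a`: `Frac A' / Frac A` is purely inseparable — «a finitely generated `A`-subalgebra of
`(Frac A)^{perf}` with a non-zero element inverted»), and ONE morphism `G : 𝒴 → 𝒳 ×_{Spec A} Spec A'`
whose fibre over EVERY field-valued point `A' → Ω` is a weak resolution (`IsWeakResolution`, p526769:
proper, regular source, isomorphism over a non-empty open). Compare `FamilyResolution k` (door 2: `A'`
merely ALGEBRAIC over `A`, generic fibre over `(Frac A)^{alg}`): over PERFECT targets only radicial base
extensions are harmless, because exactly those let every perfect-field-valued point of the generic point of
`Spec A` lift (the prover's `…FamilyResolutionInsep` files: `FamilyResolutionInsep p k →` resolution over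
every perfect `K ⊇ k` of characteristic `p`; resolution over all perfect fields of characteristic `p`
`→ FamilyResolutionInsep p k`). Vacuity (prime `p`, `CharP k p`): not trivially true (open in fibre
dimension `≥ 4`); not trivially false (follows from the summit conjunct); the existential over `L` is not
idle (it fixes WHICH generic fibre must be integral: the radicial one, i.e. the generic fibre must be
geometrically reduced and irreducible). [folklore] -/
def FamilyResolutionInsep (p : ℕ) (k : Type) [Field k] : Prop :=
  ∀ (A : Type) [CommRing A] [IsDomain A] [Algebra k A], Algebra.FiniteType k A →
    ∀ (𝒳 : Scheme.{0}) (f : 𝒳 ⟶ Spec (.of A)), IsProper f →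
      (∃ (L : Type) (_ : Field L) (_ : PerfectField L) (_ : Algebra A L),
          Function.Injective (algebraMap A L) ∧
          (∀ x : L, ∃ (n : ℕ) (a b : A), b ≠ 0 ∧ algebraMap A L b * x ^ p ^ n = algebraMap A L a) ∧
          IsIntegral (pullback f (Spec.map (CommRingCat.ofHom (algebraMap A L))))) →
      ∃ (A' : Type) (_ : CommRing A') (_ : IsDomain A') (_ : Algebra A A'),
        Function.Injective (algebraMap A A') ∧ Algebra.FiniteType A A' ∧
        (∀ x : A', ∃ (n : ℕ) (a b : A), b ≠ 0 ∧ algebraMap A A' b * x ^ p ^ n = algebraMap A A' a) ∧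
        ∃ (𝒴 : Scheme.{0})
          (G : 𝒴 ⟶ pullback f (Spec.map (CommRingCat.ofHom (algebraMap A A')))),
          ∀ (Ω : Type) [Field Ω] (φ : A' →+* Ω),
            IsWeakResolution
              (pullback.snd G
                (pullback.fst (pullback.snd f (Spec.map (CommRingCat.ofHom (algebraMap A A'))))
                  (Spec.map (CommRingCat.ofHom φ))))

/-- Anchor (pure logic): a RADICIAL extension in the above sense is in particular ALGEBRAIC elementwise in
the weak sense that every element satisfies a non-trivial relation `b · x ^ (p ^ n) = a`; recorded as the
projection of the clause, for the prover's comparison with `FamilyResolution` (door 2). [folklore] -/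
theorem FamilyResolutionInsep.exists_datum {p : ℕ} {k : Type} [Field k] (h : FamilyResolutionInsep p k)
    (A : Type) [CommRing A] [IsDomain A] [Algebra k A] [Algebra.FiniteType k A]
    (𝒳 : Scheme.{0}) (f : 𝒳 ⟶ Spec (.of A)) [IsProper f]
    (L : Type) [Field L] [PerfectField L] [Algebra A L] (hinj : Function.Injective (algebraMap A L))
    (hrad : ∀ x : L, ∃ (n : ℕ) (a b : A), b ≠ 0 ∧ algebraMap A L b * x ^ p ^ n = algebraMap A L a)
    (hint : IsIntegral (pullback f (Spec.map (CommRingCat.ofHom (algebraMap A L))))) :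
    ∃ (A' : Type) (_ : CommRing A') (_ : IsDomain A') (_ : Algebra A A'),
      Function.Injective (algebraMap A A') ∧ Algebra.FiniteType A A' ∧
      (∀ x : A', ∃ (n : ℕ) (a b : A), b ≠ 0 ∧ algebraMap A A' b * x ^ p ^ n = algebraMap A A' a) ∧
      ∃ (𝒴 : Scheme.{0})
        (G : 𝒴 ⟶ pullback f (Spec.map (CommRingCat.ofHom (algebraMap A A')))),
        ∀ (Ω : Type) [Field Ω] (φ : A' →+* Ω),
          IsWeakResolution
            (pullback.snd G
              (pullback.fst (pullback.snd f (Spec.map (CommRingCat.ofHom (algebraMap A A'))))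
                (Spec.map (CommRingCat.ofHom φ)))) :=
  h A ‹_› 𝒳 f ‹_› ⟨L, ‹_›, ‹_›, ‹_›, hinj, hrad, hint⟩

end Summit.ResolutionOfSingularities.ResolutionOfSingularities.Theorems.CampaignW82

end
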